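import Summits.QuantumAdvantage.QuantumAdvantage.Theorems.CodimDialLight
import Summits.QuantumAdvantage.AdviceFreeQNC0.AffineStakes

/-!
# CodimDial — part 4/6 «Host» (cell decomp-qadv, seat lens-5, generation 12 rev 2; supports item 30910 `SpreadDial.PureCover3`)

§9 THE HOST RING: with the all-`X` pattern `0ⁿ` and outputs supported on the odd slots, `Rel (zeroIn n) z ⟺ dot2 (oddSl n) z = n % 2` (`rel_zeroIn_iff`, all `n ≥ 3`); kernel of `0ⁿ`, slots, `dot2` bookkeeping.

Verbatim from the node file `run/shared/lean/pub/decomp-qadv/decomp-qadv-lens-5/g12/CodimDial.lean` (rev 2, sha256 b503e7e59b532c38…;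
record `…/g12/NODE-g12.md`; critic row 74 VERIFIED/CLEARED the split), re-namespaced `…Theses.CodimDial` ↦ `…Theorems.CodimDial`;
imports part 3/6 (`CodimDialLight`); joint check of parts 1–4 = `g12/tree/Parts1to4.check.lean` (farm rc 0 · 0 errors ·
0 warnings · 0 sorries).  The `def … : Prop` declarations are STATEMENTS OF THE NODE (regimes of the dial and the two pieces of the exact split
`PureCover3 ⟺ A ∧ B`), not new cruxes; the pieces to FILE are `FewCover3` / `FewBridge3` (part 6) or equivalently `LinCoverLogMed3` / `MedBridge3` (part 5).
NODE EQUATION: `AdviceFreeQNC0Three ⟸ PolyLoss3 [26123] ∧ AlgCover3 [30909] ∧ A ∧ B`, `PureCover3 (30910) ⟺ A ∧ B` (kernel).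
-/

set_option linter.style.longLine false
set_option linter.dupNamespace false

noncomputable section
open scoped Classical

namespace Summit.QuantumAdvantage.QuantumAdvantage.Theorems.CodimDial

open Finset
open Literature.Computability.QuantumComplexity Literature.Computability.QuantumComplexity.RingHLF
open Literature.Computability.MetaComplexity
open Summit.QuantumAdvantage.AdviceFreeQNC0
open Summit.QuantumAdvantage.QuantumAdvantage.Theses

/-! ## §9  The HOST: the ring with the all-`X` measurement pattern `0ⁿ` realises ONE parity row of weight `≤ n/4`

`K(0ⁿ)` = the 2-periodic vectors (`{0, 1ⁿ}` for odd `n`, `{0, 1ⁿ, 𝟙_odd, 𝟙_even}` for even `n`), all sign bits are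
`edgesIn(v) mod 2`; hence for an output string supported on the odd slots, `Rel 0ⁿ z ⟺ |z ∩ odd| ≡ n (mod 2)`
(`rel_zeroIn_iff`).  This is the tree's `rel_delta0_iff` (pattern `δ₀`, `n = 8t`) redone for the pattern `0ⁿ` and ALL `n ≥ 4`. -/

section Host
variable {n : ℕ}

/-- the all-`X` measurement pattern. -/
def zeroIn (n : ℕ) : Fin n → Bool := fun _ => false
/-- the odd slots of the ring. -/
def oddSl (n : ℕ) : Fin n → Bool := fun b => decide (b.val % 2 = 1)
/-- the even slots of the ring. -/
def evenSl (n : ℕ) : Fin n → Bool := fun b => decide (b.val % 2 = 0)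

/-- CodimDialHost helper `nxt_val` (decomp-qadv land package; see the module docstring). -/
theorem nxt_val (b : Fin n) : (nxt b).val = (b.val + 1) % n := rfl
/-- CodimDialHost helper `prv_val` (decomp-qadv land package; see the module docstring). -/
theorem prv_val (b : Fin n) : (prv b).val = (b.val + n - 1) % n := rfl

/-- CodimDialHost helper `eq_of_xor_xor_false_and'` (decomp-qadv land package; see the module docstring). -/
private theorem eq_of_xor_xor_false_and' {a b c : Bool} (h : xor (xor a b) (false && c) = false) : a = b := by
  revert a b c; decide

/-- the kernel recurrence at the zero pattern: `v ∈ K(0ⁿ) ⟺ v(b-1) = v(b+1)` for all `b`. -/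
theorem inKernel_zeroIn_iff (v : Fin n → Bool) : InKernel (zeroIn n) v ↔ ∀ b, v (prv b) = v (nxt b) := by
  unfold InKernel zeroIn
  refine forall_congr' fun b => ?_
  constructor
  · exact eq_of_xor_xor_false_and'
  · intro h; rw [h]; cases v (nxt b) <;> rfl

/-- propagation: `v_j = v_{j+2}`. -/
theorem twoPeriodic_step {v : Fin n → Bool} (h : ∀ b, v (prv b) = v (nxt b)) (j : ℕ) (hj : j + 2 < n) :
    v ⟨j, by omega⟩ = v ⟨j + 2, hj⟩ := by
  have hb := h ⟨j + 1, by omega⟩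
  have hprv : prv (⟨j + 1, by omega⟩ : Fin n) = ⟨j, by omega⟩ := Fin.ext (by
    rw [prv_val]; dsimp only
    rw [show j + 1 + n - 1 = j + n by omega, Nat.add_mod_right, Nat.mod_eq_of_lt (by omega)])
  have hnxt : nxt (⟨j + 1, by omega⟩ : Fin n) = ⟨j + 2, hj⟩ := Fin.ext (by
    rw [nxt_val]; dsimp only; exact Nat.mod_eq_of_lt hj)
  rw [hprv, hnxt] at hb
  exact hb

/-- CodimDialHost helper `twoPeriodic_even` (decomp-qadv land package; see the module docstring). -/
theorem twoPeriodic_even {v : Fin n → Bool} (h : ∀ b, v (prv b) = v (nxt b)) (hn : 2 ≤ n) :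
    ∀ i : ℕ, ∀ hi : 2 * i < n, v ⟨2 * i, hi⟩ = v ⟨0, by omega⟩ := by
  intro i
  induction i with
  | zero => intro hi; rfl
  | succ i ih =>
    intro hi
    have hs := twoPeriodic_step h (2 * i) (by omega)
    have e : (⟨2 * (i + 1), hi⟩ : Fin n) = ⟨2 * i + 2, by omega⟩ := Fin.ext (by dsimp only; omega)
    rw [e, ← hs, ih (by omega)]

/-- CodimDialHost helper `twoPeriodic_odd` (decomp-qadv land package; see the module docstring). -/
theorem twoPeriodic_odd {v : Fin n → Bool} (h : ∀ b, v (prv b) = v (nxt b)) (hn : 2 ≤ n) :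
    ∀ i : ℕ, ∀ hi : 2 * i + 1 < n, v ⟨2 * i + 1, hi⟩ = v ⟨1, by omega⟩ := by
  intro i
  induction i with
  | zero => intro hi; rfl
  | succ i ih =>
    intro hi
    have hs := twoPeriodic_step h (2 * i + 1) (by omega)
    have e : (⟨2 * (i + 1) + 1, hi⟩ : Fin n) = ⟨2 * i + 1 + 2, by omega⟩ := Fin.ext (by dsimp only; omega)
    rw [e, ← hs, ih (by omega)]

/-- a kernel vector of `0ⁿ` is determined by its first two bits. -/
theorem twoPeriodic_pattern {v : Fin n → Bool} (h : ∀ b, v (prv b) = v (nxt b)) (hn : 2 ≤ n) (b : Fin n) :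
    v b = if b.val % 2 = 0 then v ⟨0, by omega⟩ else v ⟨1, by omega⟩ := by
  obtain ⟨i, hi | hi⟩ := Nat.even_or_odd' b.val
  · have hb : b = ⟨2 * i, by omega⟩ := Fin.ext hi
    rw [if_pos (by omega), hb, twoPeriodic_even h hn i (by omega)]
  · have hb : b = ⟨2 * i + 1, by omega⟩ := Fin.ext hi
    rw [if_neg (by omega), hb, twoPeriodic_odd h hn i (by omega)]

/-- on an odd ring the kernel of `0ⁿ` is `{0, 1ⁿ}`: the first two bits agree. -/
theorem twoPeriodic_wrap {v : Fin n → Bool} (h : ∀ b, v (prv b) = v (nxt b)) (hn : 3 ≤ n) (hodd : n % 2 = 1) :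
    v ⟨0, by omega⟩ = v ⟨1, by omega⟩ := by
  have hb := h ⟨0, by omega⟩
  have hprv : prv (⟨0, by omega⟩ : Fin n) = ⟨2 * ((n - 1) / 2), by omega⟩ := Fin.ext (by
    rw [prv_val]; dsimp only
    rw [Nat.zero_add, Nat.mod_eq_of_lt (by omega)]; omega)
  have hnxt : nxt (⟨0, by omega⟩ : Fin n) = ⟨1, by omega⟩ := Fin.ext (by
    rw [nxt_val]; dsimp only; exact Nat.mod_eq_of_lt (by omega))
  rw [hprv, hnxt, twoPeriodic_even h (by omega) ((n - 1) / 2) (by omega)] at hb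
  exact hb

/-- CodimDialHost helper `ones_inKernel_zeroIn` (decomp-qadv land package; see the module docstring). -/
theorem ones_inKernel_zeroIn : InKernel (zeroIn n) (fun _ => true) :=
  (inKernel_zeroIn_iff _).mpr fun _ => rfl

/-- CodimDialHost helper `oddSl_inKernel_zeroIn` (decomp-qadv land package; see the module docstring). -/
theorem oddSl_inKernel_zeroIn (heven : n % 2 = 0) : InKernel (zeroIn n) (oddSl n) := by
  rw [inKernel_zeroIn_iff]
  intro b
  have h2 : 2 ∣ n := Nat.dvd_of_mod_eq_zero heven
  have hb := b.isLt
  have e1 : (b.val + n - 1) % 2 = (b.val + 1) % 2 := by omega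
  simp only [oddSl, prv_val, nxt_val, Nat.mod_mod_of_dvd _ h2, e1]

/-- CodimDialHost helper `wtAnd_zeroIn` (decomp-qadv land package; see the module docstring). -/
theorem wtAnd_zeroIn (v : Fin n → Bool) : wtAnd (zeroIn n) v = 0 := by
  rw [wtAnd, Finset.card_eq_zero, Finset.filter_eq_empty_iff]
  intro b _; simp [zeroIn]

/-- CodimDialHost helper `signBit_zeroIn` (decomp-qadv land package; see the module docstring). -/
theorem signBit_zeroIn (v : Fin n → Bool) : signBit (zeroIn n) v = edgesIn v % 2 := by
  rw [signBit, wtAnd_zeroIn, Nat.zero_div, Nat.add_zero]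

/-- CodimDialHost helper `edgesIn_ones` (decomp-qadv land package; see the module docstring). -/
theorem edgesIn_ones : edgesIn (fun _ : Fin n => true) = n := by
  rw [edgesIn]
  simp

/-- CodimDialHost helper `edgesIn_zeros` (decomp-qadv land package; see the module docstring). -/
theorem edgesIn_zeros : edgesIn (fun _ : Fin n => false) = 0 := by
  rw [edgesIn, Finset.card_eq_zero, Finset.filter_eq_empty_iff]
  intro b _; simp

/-- CodimDialHost helper `edgesIn_oddSl` (decomp-qadv land package; see the module docstring). -/
theorem edgesIn_oddSl (heven : n % 2 = 0) : edgesIn (oddSl n) = 0 := by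
  rw [edgesIn, Finset.card_eq_zero, Finset.filter_eq_empty_iff]
  intro b _
  simp only [oddSl, nxt_val, decide_eq_true_eq, not_and]
  intro hb
  have hlt := b.isLt
  by_cases hc : b.val + 1 < n
  · rw [Nat.mod_eq_of_lt hc]; omega
  · rw [show b.val + 1 = n by omega, Nat.mod_self]; omega

/-- CodimDialHost helper `edgesIn_evenSl` (decomp-qadv land package; see the module docstring). -/
theorem edgesIn_evenSl (heven : n % 2 = 0) : edgesIn (evenSl n) = 0 := by
  rw [edgesIn, Finset.card_eq_zero, Finset.filter_eq_empty_iff]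
  intro b _
  simp only [evenSl, nxt_val, decide_eq_true_eq, not_and]
  intro hb
  have hlt := b.isLt
  have hc : b.val + 1 < n := by omega
  rw [Nat.mod_eq_of_lt hc]; omega

/-- for a string supported on the odd slots, the even slots see nothing … -/
theorem dot2_evenSl_of_oddSupp {z : Fin n → Bool} (hz : ∀ b : Fin n, b.val % 2 = 0 → z b = false) :
    dot2 (evenSl n) z = 0 := by
  rw [dot2, Finset.card_eq_zero.mpr (Finset.filter_eq_empty_iff.mpr fun b _ => ?_)]
  simp only [evenSl, decide_eq_true_eq, not_and]
  intro hb; rw [hz b hb]; exact Bool.false_ne_true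

/-- … and the all-ones vector sees exactly what the odd slots see. -/
theorem dot2_ones_of_oddSupp {z : Fin n → Bool} (hz : ∀ b : Fin n, b.val % 2 = 0 → z b = false) :
    dot2 (fun _ => true) z = dot2 (oddSl n) z := by
  unfold dot2
  congr 2
  ext b
  simp only [Finset.mem_filter, Finset.mem_univ, true_and, oddSl, decide_eq_true_eq]
  constructor
  · intro h
    refine ⟨?_, h⟩
    by_contra hb
    have := hz b (by omega)
    rw [this] at h; exact Bool.false_ne_true h
  · intro h; exact h.2

/-- **THE HOST LEMMA**: for `n ≥ 3` and an output string supported on the odd slots,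
`Rel 0ⁿ z ⟺ |z ∩ odd| ≡ n (mod 2)`. -/
theorem rel_zeroIn_iff (hn : 3 ≤ n) {z : Fin n → Bool} (hz : ∀ b : Fin n, b.val % 2 = 0 → z b = false) :
    RingHLF.Rel (zeroIn n) z ↔ dot2 (oddSl n) z = n % 2 := by
  constructor
  · intro h
    rcases Nat.mod_two_eq_zero_or_one n with heven | hodd
    · rw [h (oddSl n) (oddSl_inKernel_zeroIn heven), signBit_zeroIn, edgesIn_oddSl heven, heven]
    · rw [← dot2_ones_of_oddSupp hz, h _ ones_inKernel_zeroIn, signBit_zeroIn, edgesIn_ones]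
  · intro h0 v hv
    rw [inKernel_zeroIn_iff] at hv
    have hpat := twoPeriodic_pattern hv (by omega)
    rw [signBit_zeroIn]
    cases h0v : v ⟨0, by omega⟩ <;> cases h1v : v ⟨1, by omega⟩
    · -- v = 0
      have hv0 : v = fun _ => false := funext fun b => by rw [hpat b, h0v, h1v, ite_self]
      rw [hv0, Summit.QuantumAdvantage.AdviceFreeQNC0.Fib19.dot2_zero_left, edgesIn_zeros]
    · -- v = 𝟙_odd (even n only)
      rcases Nat.mod_two_eq_zero_or_one n with heven | hodd
      · have hv1 : v = oddSl n := funext fun b => by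
          rw [hpat b, h0v, h1v]; unfold oddSl
          by_cases hb : b.val % 2 = 0
          · rw [if_pos hb]; symm; rw [decide_eq_false_iff_not]; omega
          · rw [if_neg hb]; symm; rw [decide_eq_true_eq]; omega
        rw [hv1, h0, edgesIn_oddSl heven, heven]
      · have := twoPeriodic_wrap hv hn hodd
        rw [h0v, h1v] at this; exact absurd this Bool.false_ne_true
    · -- v = 𝟙_even (even n only)
      rcases Nat.mod_two_eq_zero_or_one n with heven | hodd
      · have hv1 : v = evenSl n := funext fun b => by
          rw [hpat b, h0v, h1v]; unfold evenSl
          by_cases hb : b.val % 2 = 0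
          · rw [if_pos hb]; symm; rw [decide_eq_true_eq]; exact hb
          · rw [if_neg hb]; symm; rw [decide_eq_false_iff_not]; exact hb
        rw [hv1, dot2_evenSl_of_oddSupp hz, edgesIn_evenSl heven]
      · have := twoPeriodic_wrap hv hn hodd
        rw [h0v, h1v] at this; exact absurd this.symm Bool.false_ne_true
    · -- v = 1ⁿ
      have hv1 : v = fun _ => true := funext fun b => by rw [hpat b, h0v, h1v, ite_self]
      rw [hv1, dot2_ones_of_oddSupp hz, h0, edgesIn_ones]

end Host

end Summit.QuantumAdvantage.QuantumAdvantage.Theorems.CodimDial
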